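import Summits.CriticalPhenomena.PercolationContinuityZ3.Theorems.FK.InfiniteVolumeDLRFinite
import Literature.Probability.LatticeModels.RandomClusterExploredWiring
import HarnessLib

/-!
# FK-continuity transplant, FO-10 (domain-Markov toolkit, seat A), finite volume: conditioning a
# random-cluster measure on a history that FORCES A WIRING — the lower domination crediting it

Cell `fk-continuity` (bschramm), row FO-10a; support file for the FK-continuity transplant
(`--supports stmt-CriticalPhenomena-4575`); builds on p205010 (kernel theorem, internal audit signed; external
expert review pending).  Pure proofs over the tree's finite-graph random-cluster measure `rcMeasure G p q B`
(Grimmett 2006, (1.2); wired vertex sets §4.2), in the off-region-cylinder formalism of the companion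
`InfiniteVolumeDLRFinite.lean` (FO-06a).  No definitions, no named facts, no sorries.

## What is proved (Grimmett 2006, Lemma (4.13) with Lemma (4.14)(b), `q ≥ 1`)

Grimmett's Lemma (4.13) says that, conditionally on the configuration `ξ` off a region, the law inside the region
is the random-cluster measure of the region with the boundary condition INDUCED by `ξ`; Lemma (4.14)(b) says
that this measure increases (stochastically) with the connections `ξ` provides ("the greater the connections
off `Λ`, the larger is the induced measure within `Λ`", p. 72).  The tree holds the two dominations that ignore
the detail of `ξ` — from above by the measure wired on every vertex `ξ` touches
(`rcMeasure_real_inter_cylinder_le_mul_fromEdgeSet`), from below by the measure wired on the ambient set `B`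
only (`rcMeasure_real_inter_cylinder_le_mul_fromEdgeSet_of_isLowerSet`, `B₀ ⊆ B`; summed over a history in
FO-06a's `rcMeasure_fromEdgeSet_real_mul_le_real_inter`) — and the exact law when `ξ` hangs off the wired set
(`RandomClusterExploredWiring.lean`).  Exploration arguments of Kozma–Nitzan type need the intermediate case:
the history reveals an open SEED (say an open cube) touching the fresh region, and one wants the law inside the
region to dominate the region's measure WITH THE SEED'S VERTICES WIRED, whatever else the history says.  Here:

* `clusterCount_add_clusterCount_union_le_of_reachable` — the lattice (Holley) inequality
  `k^{W₀}(a) + k^B(b ∪ ξ) ≤ k^{W₀}(a ∩ b) + k^B((a ∪ b) ∪ ξ)` whenever the vertex set `W₀` lies inside ONE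
  cluster of `⟨ξ⟩ ∨ K_B` (every two vertices of `W₀` joined by a path of `ξ`-open edges and `B`-wirings);
  the tree's `clusterCount_add_clusterCount_union_le` is the case `W₀ = B₀ ⊆ B`.
* `rcMeasure_real_inter_cylinder_le_mul_fromEdgeSet_of_isLowerSet_of_reachable` — for a region `U ⊆ E(G)`,
  a configuration `ξ` off `U` joining all of `W₀` (through `ξ` and the wiring of `B`), and a DECREASING event
  `D`: `φ^B_G({ω ∩ U ∈ D} ∩ {ω ∖ U = ξ}) ≤ φ^B_G({ω ∖ U = ξ}) · φ^{W₀}_{⟨U⟩}(D)`.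
* `rcMeasure_real_cylinder_mul_fromEdgeSet_le_of_reachable` — the same for an INCREASING event `A`, as the
  lower bound `φ^B_G({ω ∖ U = ξ}) · φ^{W₀}_{⟨U⟩}(A) ≤ φ^B_G({ω ∩ U ∈ A} ∩ {ω ∖ U = ξ})`: conditionally on
  `ω ∖ U = ξ`, the configuration inside `U` dominates the measure of `⟨U⟩` with `W₀` wired.

The forms SUMMED over a history event all of whose patterns join `W₀`, their transport to a region of `ℤ^d`
inside a box, and the infinite-volume versions over the cell's box limits `IsBoxLimit` (history-forced wiring
under `φ^b_{p,q}`) are the companion `DomainMarkovForcedWiringLimit.lean`.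

## References

* G. Grimmett, *The Random-Cluster Model*, Springer 2006: §3.4 Thm. (3.8) eq. (3.12) (supermodularity of
  cluster counts), §4.2 (4.11)–(4.13), Lemma (4.13) p. 70, Lemma (4.14)(b) p. 71 (proof p. 72–73).
  [Grimmett2006]
* R. Holley, *Remarks on the FKG inequalities*, Comm. Math. Phys. 36 (1974) 227–231; Mathlib `holley`.
-/

noncomputable section

open MeasureTheory Set Filter
open scoped Topology ENNReal

namespace Summit.CriticalPhenomena.PercolationContinuityZ3.Theorems.FK

open Literature.Probability.Percolation Literature.Probability.LatticeModels

/-! ### The lattice inequality: a frozen configuration that already joins the seed -/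

section ClusterCount

open SimpleGraph

variable {V : Type*} [Finite V]

/-- **Mixed supermodularity of cluster counts, crediting the wiring forced by a frozen configuration**: if every
two vertices of `W₀` are joined in `⟨ξ⟩ ∨ K_B` (a path of `ξ`-open edges and `B`-wirings), then for all edge
sets `a, b`, `k^{W₀}(a) + k^B(b ∪ ξ) ≤ k^{W₀}(a ∩ b) + k^B((a ∪ b) ∪ ξ)`.  Proof: wiring `W₀` on top of
`⟨b ∪ ξ⟩ ∨ K_B` changes no component (the new edges join already-joined vertices), and then Grimmett's
supermodularity (3.12) applies to `⟨a⟩ ∨ K_{W₀}` and `⟨b ∪ ξ⟩ ∨ K_B ∨ K_{W₀}`.  The tree's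
`clusterCount_add_clusterCount_union_le` is the case `W₀ ⊆ B`. [cite: Grimmett2006, Thm. (3.8) eq. (3.12) and Lemma (4.14)(b)] -/
theorem clusterCount_add_clusterCount_union_le_of_reachable {a b ξ : BondConfig V} {B W₀ : Set V}
    (hW₀ : ∀ x ∈ W₀, ∀ y ∈ W₀, (fromEdgeSet ξ ⊔ wired B).Reachable x y) :
    clusterCount a W₀ + clusterCount (b ∪ ξ) B ≤
      clusterCount (a ∩ b) W₀ + clusterCount ((a ∪ b) ∪ ξ) B := by
  unfold clusterCount Literature.Probability.Percolation.openGraph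
  rw [fromEdgeSet_union, fromEdgeSet_union, fromEdgeSet_union, fromEdgeSet_inter]
  set Y : SimpleGraph V := fromEdgeSet a ⊔ wired W₀ with hY
  set X : SimpleGraph V := fromEdgeSet b ⊔ fromEdgeSet ξ ⊔ wired B with hX
  set X' : SimpleGraph V := X ⊔ wired W₀ with hX'
  -- wiring `W₀` on top of `⟨b⟩ ∨ ⟨ξ⟩ ∨ K_B` does not change the components
  have hξX : fromEdgeSet ξ ⊔ wired B ≤ X := sup_le (le_sup_right.trans le_sup_left) le_sup_right
  have hXX' : Nat.card X.ConnectedComponent = Nat.card X'.ConnectedComponent := by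
    refine card_connectedComponent_eq_of_le_of_adj_imp_reachable le_sup_left fun v w hvw => ?_
    rcases hvw with hvw | hvw
    · exact Adj.reachable hvw
    · rw [wired_adj] at hvw
      obtain ⟨-, hv, hw⟩ := hvw
      exact (hW₀ v hv w hw).mono hξX
  have hbX' : fromEdgeSet b ≤ X' := (le_sup_left.trans le_sup_left).trans le_sup_left
  have h1 : fromEdgeSet a ⊓ fromEdgeSet b ⊔ wired W₀ ≤ Y ⊓ X' :=
    sup_le (le_inf (inf_le_left.trans le_sup_left) (inf_le_right.trans hbX'))
      (le_inf le_sup_right le_sup_right)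
  have h2 : fromEdgeSet a ⊔ fromEdgeSet b ⊔ fromEdgeSet ξ ⊔ wired B ≤ Y ⊔ X' :=
    sup_le (sup_le (sup_le (le_sup_left.trans le_sup_left) (hbX'.trans le_sup_right))
      (((le_sup_right.trans le_sup_left).trans le_sup_left).trans le_sup_right))
      ((le_sup_right.trans le_sup_left).trans le_sup_right)
  calc Nat.card Y.ConnectedComponent + Nat.card X.ConnectedComponent
      = Nat.card Y.ConnectedComponent + Nat.card X'.ConnectedComponent := by rw [hXX']
    _ ≤ Nat.card (Y ⊓ X').ConnectedComponent + Nat.card (Y ⊔ X').ConnectedComponent :=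
        card_connectedComponent_supermodular _ _
    _ ≤ Nat.card (fromEdgeSet a ⊓ fromEdgeSet b ⊔ wired W₀).ConnectedComponent +
          Nat.card (fromEdgeSet a ⊔ fromEdgeSet b ⊔ fromEdgeSet ξ ⊔ wired B).ConnectedComponent :=
        add_le_add (ConnectedComponent.card_le_card_of_le h1) (ConnectedComponent.card_le_card_of_le h2)

omit [Finite V] in
/-- Reachability in `⟨ξ⟩ ∨ K_B` is monotone in the frozen configuration `ξ`. [folklore] -/
theorem reachable_fromEdgeSet_sup_wired_mono {ξ ξ' : BondConfig V} (h : ξ ⊆ ξ') (B : Set V) {x y : V}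
    (hxy : (fromEdgeSet ξ ⊔ wired B).Reachable x y) : (fromEdgeSet ξ' ⊔ wired B).Reachable x y :=
  hxy.mono (sup_le_sup_right (fromEdgeSet_mono h) _)

end ClusterCount

/-! ### Conditioning on a cylinder whose pattern joins the seed: domination from below -/

section Finite

open Finset SimpleGraph

variable {V : Type*} [Fintype V] [DecidableEq V] (G : SimpleGraph V) [DecidableRel G.Adj]

/-- **Conditionally on a configuration off the region that joins the seed `W₀`, decreasing events inside the
region are at most as likely as under the measure of the region with `W₀` wired** (Grimmett 2006, Lemma (4.13)
with Lemma (4.14)(b): the induced boundary condition dominates the one wiring only `W₀`).  Let `U ⊆ E(G)` be the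
region, `ξ` any configuration, and `W₀` a vertex set every two of whose vertices are joined in `⟨ξ⟩ ∨ K_B`.  Then
for every decreasing event `D`,
`φ^B_{G,p,q}({ω ∩ U ∈ D} ∩ {ω ∖ U = ξ}) ≤ φ^B_{G,p,q}({ω ∖ U = ξ}) · φ^{W₀}_{⟨U⟩,p,q}(D)` (`0 ≤ p ≤ 1`,
`q ≥ 1`).  Holley's inequality between the weights of `⟨U⟩` wired on `W₀` and the conditional weights
`a ↦ w^B_G(a ∪ ξ)`, whose condition is `clusterCount_add_clusterCount_union_le_of_reachable`; the tree's
`rcMeasure_real_inter_cylinder_le_mul_fromEdgeSet_of_isLowerSet` is the case `W₀ = B`.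
[cite: Grimmett2006, Lemma (4.13) and Lemma (4.14)(b)] -/
theorem rcMeasure_real_inter_cylinder_le_mul_fromEdgeSet_of_isLowerSet_of_reachable {p q : ℝ}
    (hp : p ∈ Set.Icc (0 : ℝ) 1) (hq : 1 ≤ q) (B : Set V) (U : Finset (Sym2 V))
    (hU : U ⊆ G.edgeFinset) (ξ : Set (Sym2 V)) {W₀ : Set V}
    (hW₀ : ∀ x ∈ W₀, ∀ y ∈ W₀, (fromEdgeSet ξ ⊔ wired B).Reachable x y)
    {D : Set (BondConfig V)} (hD : IsLowerSet D) :
    (rcMeasure G p q B).real ({ω | ω ∩ ↑U ∈ D} ∩ {ω | ω ∩ (↑U : Set (Sym2 V))ᶜ = ξ}) ≤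
      (rcMeasure G p q B).real {ω | ω ∩ (↑U : Set (Sym2 V))ᶜ = ξ} *
        (rcMeasure (fromEdgeSet (U : Set (Sym2 V))) p q W₀).real D := by
  classical
  have hq0 : 0 < q := one_pos.trans_le hq
  have hZ := rcPartitionFunction_pos G hp hq0 B
  haveI : IsProbabilityMeasure (rcMeasure G p q B) := isProbabilityMeasure_rcMeasure G hp hq0 B
  set φ := rcMeasure G p q B with hφ
  set X : Set (BondConfig V) := {ω | ω ∩ ↑U ∈ D} with hX
  set X' : Set (BondConfig V) := {ω | ω ∩ ↑U ∈ Dᶜ} with hX'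
  set C : Set (BondConfig V) := {ω | ω ∩ (↑U : Set (Sym2 V))ᶜ = ξ} with hC
  by_cases hex : ∃ ω₀ : Finset (Sym2 V), ω₀ ⊆ G.edgeFinset ∧ (↑ω₀ : Set (Sym2 V)) ∩ (↑U)ᶜ = ξ
  swap
  · have hC0 : φ.real C = 0 := by
      rw [hφ, rcMeasure_real_apply G hp hq0 B C]
      refine Finset.sum_eq_zero fun ω hω => if_neg fun hωC => hex ⟨ω, Finset.mem_powerset.1 hω, hωC⟩
    have h0 : φ.real (X ∩ C) = 0 :=
      le_antisymm ((measureReal_mono Set.inter_subset_right (measure_ne_top φ C)).trans hC0.le)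
        measureReal_nonneg
    rw [h0, hC0, zero_mul]
  obtain ⟨ω₀, hω₀E, hω₀⟩ := hex
  set ζ₀ : Finset (Sym2 V) := ω₀ \ U with hζ₀def
  have hζ₀ : (↑ζ₀ : Set (Sym2 V)) = ξ := by rw [hζ₀def, Finset.coe_sdiff]; exact hω₀
  have hζ₀E : ζ₀ ⊆ G.edgeFinset \ U := Finset.sdiff_subset_sdiff hω₀E le_rfl
  have hζ₀U : Disjoint ζ₀ U := Finset.disjoint_of_subset_left hζ₀E sdiff_disjoint
  have hW₀' : ∀ x ∈ W₀, ∀ y ∈ W₀, (fromEdgeSet (↑ζ₀ : Set (Sym2 V)) ⊔ wired B).Reachable x y := by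
    rw [hζ₀]; exact hW₀
  set GU : SimpleGraph V := fromEdgeSet (U : Set (Sym2 V)) with hGU
  have hEU : ∀ i : Fintype GU.edgeSet, @SimpleGraph.edgeFinset V GU i = U := fun i =>
    @edgeFinset_fromEdgeSet_of_subset V _ G _ U hU i
  have hZU := rcPartitionFunction_pos GU hp hq0 W₀
  set N : ℝ := ∑ η ∈ U.powerset, rcWeight G p q B (η ∪ ζ₀) with hN
  have hNC : rcPartitionFunction G p q B * φ.real C = N := by
    have h := rcPartitionFunction_mul_real_inter_cylinder G hp hq0 B hU hζ₀E
      (Set.univ : Set (BondConfig V))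
    rw [hζ₀] at h
    simp only [Set.mem_univ, if_true, mul_one, Set.setOf_true, Set.univ_inter] at h
    exact h
  have hNX' : rcPartitionFunction G p q B * φ.real (X' ∩ C) =
      ∑ η ∈ U.powerset, rcWeight G p q B (η ∪ ζ₀) *
        (if (↑η : BondConfig V) ∈ Dᶜ then 1 else 0) := by
    have h := rcPartitionFunction_mul_real_inter_cylinder G hp hq0 B hU hζ₀E Dᶜ
    rw [hζ₀] at h
    exact h
  rcases eq_or_lt_of_le (measureReal_nonneg : 0 ≤ φ.real C) with hC0 | hCpos
  · have h0 : φ.real (X ∩ C) = 0 :=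
      le_antisymm ((measureReal_mono Set.inter_subset_right (measure_ne_top φ C)).trans hC0.symm.le)
        measureReal_nonneg
    rw [h0, ← hC0, zero_mul]
  have hNpos : 0 < N := by rw [← hNC]; exact mul_pos hZ hCpos
  -- Holley: `f` = weights of `⟨U⟩` wired on `W₀`, `g` = conditional weights, tested against `1_{Dᶜ}`
  set g : Finset (Sym2 V) → ℝ := fun a => if a ⊆ U then rcWeight G p q B (a ∪ ζ₀) / N else 0 with hg
  set f : Finset (Sym2 V) → ℝ := fun b =>
    (if b ⊆ U then rcWeight GU p q W₀ b else 0) / rcPartitionFunction GU p q W₀ with hf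
  set μ : Finset (Sym2 V) → ℝ := fun a => if (↑a : BondConfig V) ∈ Dᶜ then 1 else 0 with hμ
  have hg0 : 0 ≤ g := fun a => by
    simp only [hg]
    split_ifs
    · exact div_nonneg (rcWeight_nonneg G hp hq0.le B _) hNpos.le
    · exact le_rfl
  have hf0 : 0 ≤ f := fun b => by
    simp only [hf]
    split_ifs
    · exact div_nonneg (rcWeight_nonneg GU hp hq0.le W₀ _) hZU.le
    · rw [zero_div]; exact le_rfl
  have hμ0 : 0 ≤ μ := fun a => by simp only [hμ, Pi.zero_apply]; split_ifs <;> norm_num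
  have hDc : IsUpperSet Dᶜ := hD.compl
  have hμm : Monotone μ := by
    intro a b hab
    simp only [hμ]
    by_cases ha : (↑a : BondConfig V) ∈ Dᶜ
    · have hb : (↑b : BondConfig V) ∈ Dᶜ := hDc (Finset.coe_subset.2 hab) ha
      simp [ha, hb]
    · simp only [ha, if_false]; split_ifs <;> norm_num
  have hfilter : (Finset.univ : Finset (Finset (Sym2 V))).filter (· ⊆ U) = U.powerset := by
    ext ω; simp
  have hsumg : ∀ F : Finset (Sym2 V) → ℝ,
      ∑ a, F a * g a = (∑ a ∈ U.powerset, rcWeight G p q B (a ∪ ζ₀) * F a) / N := by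
    intro F
    rw [Finset.sum_div, ← hfilter, Finset.sum_filter]
    refine Finset.sum_congr rfl fun a _ => ?_
    simp only [hg]
    split_ifs <;> ring
  have hsumf : ∀ F : Finset (Sym2 V) → ℝ,
      ∑ b, F b * f b = ∑ b ∈ U.powerset, F b * (rcWeight GU p q W₀ b / rcPartitionFunction GU p q W₀) := by
    intro F
    rw [← hfilter, Finset.sum_filter]
    refine Finset.sum_congr rfl fun b _ => ?_
    simp only [hf]
    split_ifs <;> simp
  have hgsum : ∑ a, g a = 1 := by
    have h := hsumg fun _ => 1
    simp only [one_mul, mul_one] at h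
    rw [h, ← hN, div_self hNpos.ne']
  have hfsum : ∑ b, f b = 1 := by
    have h := hsumf fun _ => 1
    simp only [one_mul] at h
    rw [h, ← Finset.sum_div, div_eq_one_iff_eq hZU.ne', rcPartitionFunction, hEU]
  have hcond : ∀ a b, f a * g b ≤ f (a ⊓ b) * g (a ⊔ b) := by
    intro a b
    have hrhs : 0 ≤ f (a ⊓ b) * g (a ⊔ b) := mul_nonneg (hf0 _) (hg0 _)
    by_cases hb : b ⊆ U
    swap
    · simp only [hg, if_neg hb, mul_zero]; exact hrhs
    by_cases ha : a ⊆ U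
    swap
    · have : f a = 0 := by simp only [hf, if_neg ha, zero_div]
      rw [this, zero_mul]; exact hrhs
    have hab : a ⊓ b ⊆ U := Finset.inter_subset_left.trans ha
    have hab' : a ⊔ b ⊆ U := Finset.union_subset ha hb
    simp only [hf, hg, if_pos ha, if_pos hb, if_pos hab, if_pos hab']
    rw [div_mul_div_comm, div_mul_div_comm]
    refine div_le_div_of_nonneg_right ?_ (mul_pos hZU hNpos).le
    -- the weight inequality `w^{W₀}_U(a) w^B_G(b ∪ ζ₀) ≤ w^{W₀}_U(a ∩ b) w^B_G((a ∪ b) ∪ ζ₀)`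
    rw [Finset.inf_eq_inter, Finset.sup_eq_union]
    simp only [rcWeight, hEU]
    have hbE : b ⊆ G.edgeFinset := hb.trans hU
    have habE : a ∪ b ⊆ G.edgeFinset := hab'.trans hU
    have hζE : ζ₀ ⊆ G.edgeFinset := hζ₀E.trans sdiff_subset
    have hdisj : Disjoint b ζ₀ := (hζ₀U.symm).mono_left hb
    have hdisj' : Disjoint (a ∪ b) ζ₀ := (hζ₀U.symm).mono_left hab'
    have h1 : #(b ∪ ζ₀) = #b + #ζ₀ := Finset.card_union_of_disjoint hdisj
    have h2 : #(a ∪ b ∪ ζ₀) = #(a ∪ b) + #ζ₀ := Finset.card_union_of_disjoint hdisj'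
    have h3 : #(G.edgeFinset \ (b ∪ ζ₀)) = #G.edgeFinset - #(b ∪ ζ₀) :=
      card_sdiff_of_subset (Finset.union_subset hbE hζE)
    have h4 : #(G.edgeFinset \ (a ∪ b ∪ ζ₀)) = #G.edgeFinset - #(a ∪ b ∪ ζ₀) :=
      card_sdiff_of_subset (Finset.union_subset habE hζE)
    have h5 : #(U \ a) = #U - #a := card_sdiff_of_subset ha
    have h6 : #(U \ (a ∩ b)) = #U - #(a ∩ b) := card_sdiff_of_subset hab
    have h7 : #(a ∪ b ∪ ζ₀) ≤ #G.edgeFinset := card_le_card (Finset.union_subset habE hζE)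
    have h8 : #a ≤ #U := card_le_card ha
    have h9 : #(a ∩ b) ≤ #a := card_le_card Finset.inter_subset_left
    have h10 : #a + #b = #(a ∩ b) + #(a ∪ b) := by
      rw [add_comm (#(a ∩ b)), Finset.card_union_add_card_inter]
    obtain ⟨m, hm⟩ : ∃ m, #a = #(a ∩ b) + m := Nat.exists_eq_add_of_le h9
    have e1 : #(U \ (a ∩ b)) = #(U \ a) + m := by omega
    have e2 : #(a ∪ b ∪ ζ₀) = #(b ∪ ζ₀) + m := by omega
    have e3 : #(G.edgeFinset \ (b ∪ ζ₀)) = #(G.edgeFinset \ (a ∪ b ∪ ζ₀)) + m := by omega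
    rw [hm, e1, e2, e3]
    have hki : clusterCount (↑a : BondConfig V) W₀ ≤ clusterCount (↑(a ∩ b) : BondConfig V) W₀ :=
      clusterCount_anti (Finset.coe_subset.2 Finset.inter_subset_left) W₀
    have hku : clusterCount (↑(a ∪ b ∪ ζ₀) : BondConfig V) B ≤ clusterCount (↑(b ∪ ζ₀) : BondConfig V) B :=
      clusterCount_anti (Finset.coe_subset.2
        (Finset.union_subset_union Finset.subset_union_right le_rfl)) B
    have hk : clusterCount (↑a : BondConfig V) W₀ + clusterCount (↑(b ∪ ζ₀) : BondConfig V) B ≤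
        clusterCount (↑(a ∩ b) : BondConfig V) W₀ + clusterCount (↑(a ∪ b ∪ ζ₀) : BondConfig V) B := by
      rw [Finset.coe_union, Finset.coe_union, Finset.coe_union, Finset.coe_inter]
      exact clusterCount_add_clusterCount_union_le_of_reachable hW₀'
    exact rcWeight_holley_aux hp.1 le_rfl hp.2 hq0.le le_rfl hq hki hku hk
  have key := _root_.holley f g μ hμ0 hf0 hg0 hμm (hfsum.trans hgsum.symm) hcond
  -- identify the two sides: `ν(Dᶜ) ≤ φ(Dᶜ | C)`, i.e. `φ(D | C) ≤ ν(D)`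
  haveI : IsProbabilityMeasure (rcMeasure GU p q W₀) := isProbabilityMeasure_rcMeasure GU hp hq0 W₀
  have hlhs : ∑ b, μ b * f b = (rcMeasure GU p q W₀).real Dᶜ := by
    rw [rcMeasure_real_eq_sum_indicator_mul GU hp hq0 W₀ Dᶜ]
    refine Finset.sum_congr rfl fun b _ => ?_
    rw [hEU]
  have hrhs : ∑ a, μ a * g a = φ.real (X' ∩ C) / φ.real C := by
    rw [hsumg, ← mul_div_mul_left (φ.real (X' ∩ C)) (φ.real C) hZ.ne', hNC]
    congr 1
    exact hNX'.symm
  rw [hlhs, hrhs, le_div_iff₀ hCpos] at key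
  -- complements: `φ(X' ∩ C) = φ(C) - φ(X ∩ C)`, `ν(Dᶜ) = 1 - ν(D)`
  have hsplit : φ.real (X' ∩ C) = φ.real C - φ.real (X ∩ C) := by
    have hdisj : Disjoint (X ∩ C) (X' ∩ C) := Set.disjoint_left.2 fun ω h₁ h₂ => h₂.1 h₁.1
    have hunion : (X ∩ C) ∪ (X' ∩ C) = C := by
      ext ω
      simp only [hX, hX', Set.mem_union, Set.mem_inter_iff, Set.mem_setOf_eq, Set.mem_compl_iff]
      tauto
    have h := measureReal_union (μ := φ) hdisj MeasurableSet.of_discrete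
    rw [hunion] at h
    linarith
  have hcompl : (rcMeasure GU p q W₀).real Dᶜ = 1 - (rcMeasure GU p q W₀).real D :=
    probReal_compl_eq_one_sub MeasurableSet.of_discrete
  rw [hsplit, hcompl] at key
  nlinarith [key, measureReal_nonneg (μ := φ) (s := C)]

/-- **Conditionally on a configuration off the region that joins the seed `W₀`, the configuration inside the
region dominates the measure of the region with `W₀` wired** (Grimmett 2006, Lemma (4.13) with Lemma (4.14)(b)),
stated for an INCREASING event `A` as the lower bound
`φ^B_{G,p,q}({ω ∖ U = ξ}) · φ^{W₀}_{⟨U⟩,p,q}(A) ≤ φ^B_{G,p,q}({ω ∩ U ∈ A} ∩ {ω ∖ U = ξ})`, i.e.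
`φ^{W₀}_{⟨U⟩}(A) ≤ φ^B_G(ω ∩ U ∈ A | ω ∖ U = ξ)` whenever the cylinder is non-null (complement of the
decreasing form). [cite: Grimmett2006, Lemma (4.13) and Lemma (4.14)(b)] -/
theorem rcMeasure_real_cylinder_mul_fromEdgeSet_le_of_reachable {p q : ℝ}
    (hp : p ∈ Set.Icc (0 : ℝ) 1) (hq : 1 ≤ q) (B : Set V) (U : Finset (Sym2 V))
    (hU : U ⊆ G.edgeFinset) (ξ : Set (Sym2 V)) {W₀ : Set V}
    (hW₀ : ∀ x ∈ W₀, ∀ y ∈ W₀, (fromEdgeSet ξ ⊔ wired B).Reachable x y)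
    {A : Set (BondConfig V)} (hA : IsUpperSet A) :
    (rcMeasure G p q B).real {ω | ω ∩ (↑U : Set (Sym2 V))ᶜ = ξ} *
        (rcMeasure (fromEdgeSet (U : Set (Sym2 V))) p q W₀).real A ≤
      (rcMeasure G p q B).real ({ω | ω ∩ ↑U ∈ A} ∩ {ω | ω ∩ (↑U : Set (Sym2 V))ᶜ = ξ}) := by
  have hq0 : 0 < q := one_pos.trans_le hq
  set φ := rcMeasure G p q B with hφ
  set ν := rcMeasure (fromEdgeSet (U : Set (Sym2 V))) p q W₀ with hν
  haveI : IsProbabilityMeasure φ := isProbabilityMeasure_rcMeasure G hp hq0 B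
  haveI : IsProbabilityMeasure ν := isProbabilityMeasure_rcMeasure _ hp hq0 W₀
  set C : Set (BondConfig V) := {ω | ω ∩ (↑U : Set (Sym2 V))ᶜ = ξ} with hC
  -- the decreasing form for `Aᶜ`
  have hdom := rcMeasure_real_inter_cylinder_le_mul_fromEdgeSet_of_isLowerSet_of_reachable G hp hq B U hU ξ
    hW₀ (D := Aᶜ) hA.compl
  rw [← hφ, ← hν, ← hC] at hdom
  have hsplit : φ.real ({ω | ω ∩ ↑U ∈ A} ∩ C) + φ.real ({ω | ω ∩ ↑U ∈ Aᶜ} ∩ C) = φ.real C := by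
    have hdisj : Disjoint ({ω : BondConfig V | ω ∩ ↑U ∈ A} ∩ C) ({ω | ω ∩ ↑U ∈ Aᶜ} ∩ C) :=
      Set.disjoint_left.2 fun ω h₁ h₂ => h₂.1 h₁.1
    have hunion : ({ω : BondConfig V | ω ∩ ↑U ∈ A} ∩ C) ∪ ({ω | ω ∩ ↑U ∈ Aᶜ} ∩ C) = C := by
      ext ω
      simp only [Set.mem_union, Set.mem_inter_iff, Set.mem_setOf_eq, Set.mem_compl_iff]
      tauto
    have h := measureReal_union (μ := φ) hdisj MeasurableSet.of_discrete
    rw [hunion] at h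
    linarith
  have hνc : ν.real Aᶜ = 1 - ν.real A := probReal_compl_eq_one_sub MeasurableSet.of_discrete
  rw [hνc] at hdom
  nlinarith [hdom, hsplit, measureReal_nonneg (μ := φ) (s := C)]

end Finite

end Summit.CriticalPhenomena.PercolationContinuityZ3.Theorems.FK

end
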